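import Summits.ValiantsHypothesis.ValiantsHypothesis.Theorems.FifoMatchingNFPolytopeQuasiPolyXC
import Literature.Combinatorics.Optimization.GridCorCliqueFace
import HarnessLib

/-!
# K1 `NFPolytopeQuasiPolyXC` (stmt-ValiantsHypothesis-26254) holds UNCONDITIONALLY

The conditional closer `QueueGridFace.nfPolytopeQuasiPolyXC_of_AboulkerEtAl2019` (c1 g5, p618136:
K1 from the ONE named print fact `AboulkerEtAl2019_corGridMinor`, AFHMS 2019 Thm. 6) applied to the
fact's DISCHARGE `Literature.Combinatorics.Optimization.AboulkerEtAl2019_corGridMinor_holds`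
(`GridCorCliqueFace.lean`: the G♭ construction `AboulkerEtAl2019_gridCorCliqueFace` + Observation 5
`AboulkerEtAl2019_corGridMinor_iff_grid` + Kaibel–Weltge): THE NEST-FREE PERFECT-MATCHING POLYTOPE
`NFP(2n) = Newt(NN_n)` HAS SUPER-QUASI-POLYNOMIAL EXTENSION COMPLEXITY, now with no hypothesis.
Honest frame: K1 is a route item of `ValiantsHypothesis/FifoMatching` (monotone / polyhedral
currency); VP ≠ VNP is NOT proved; nothing here is a summit statement.
-/

-- Sub = Summit single-conjunct layout: the duplicated namespace component is mandated by the tree.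
set_option linter.dupNamespace false

namespace Summit.ValiantsHypothesis.ValiantsHypothesis.Theorems.FifoMatching.QueueGridFace

/-- **Item stmt-ValiantsHypothesis-26254 `NFPolytopeQuasiPolyXC` — proved, unconditionally** (exact type
of the route decl): the conditional closer applied to the discharged AFHMS fact.
[cite: AboulkerEtAl2019, Thm. 6; FioriniEtAl2015, Lemma 9; KaibelWeltge2014, Thm. 1] -/
theorem nfPolytopeQuasiPolyXC_holds :
    Summit.ValiantsHypothesis.ValiantsHypothesis.Theses.FifoMatching.NFPolytopeQuasiPolyXC :=
  nfPolytopeQuasiPolyXC_of_AboulkerEtAl2019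
    Literature.Combinatorics.Optimization.AboulkerEtAl2019_corGridMinor_holds

end Summit.ValiantsHypothesis.ValiantsHypothesis.Theorems.FifoMatching.QueueGridFace
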